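import Literature.MathematicalPhysics.QuantumFieldTheory.Balaban1983to89.Node00.Sect2FrameOfRecord

/-!
# NODE 00 — torus geometry of the (I.1.11)–(1.16) regions of record: monotonicity of `Sect2.enlT` ∕ `Sect2.innerT` ∕
# `Sect2.regionOfSet`, the enlargement ladder `Y^{∼a} ⊆ (Y^{∼(a+b)})^{∼−b}`, the stencil of a plaquette inside a region, and the
# faces `X₂ ⊆ X`, `X ↦ frameI … X` monotone of 11b's frames `Sect2.frameI`

Seat `pub-ymgap-dag-n09-c` (g2), 2026-08-26; dag-lead FAN-OUT v1.1 §N09 s1 (conjunct 1 of N09: Lemma 4 (3.53) of [Balaban1987RG1] for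
the non-trivial package at NODE 00's objects).  THEOREMS ONLY; imports 11b `Node00/Sect2FrameOfRecord` and nothing else; no `def`, no
`instance`, no `notation`, no `sorry`.

PURPOSE.  NODE 00's [B12 §§2–5] carrier pin (`Node00/CarriersB12`: `IdxB12.boxT n = □̃ⁿ := Sect2.enlT _ (side L M (k+1)) n □`,
`ResidB12Run.frameX ∕ frameBox ∕ regionY` = `Sect2.frameI Rz M j X`, `Sect2.frameI Rz M (k+1) □̃⁵`, `Sect2.regionOfSet (□̃³)`) DISPLAYS,
as hypotheses of its by-reference package, the seven region inclusions of print's FUNDAMENTAL CASE of Lemma 4 (p. 275: «Let us consider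
at first the fundamental case X ⊂ □̃²», «□₀ = □̃⁵»; (3.37)∕(3.40) «on □̃³»): `X ⊂ Y = □̃³`, `X̃⁻² ⊂ X`, `X, Y ⊂ (□̃⁵)^{∼−2}` read on the
plaquettes ∕ bonds ∕ derivative stencils of `Sect2.regionOfSet`.  Those are finite torus combinatorics.  This module proves their GENERIC
half — for arbitrary site sets `Y ⊂ T_η` and cube side `s` — so that the sequel instantiates them at `□`, `X`:

* §1 (cover side, r11's `B14DomainGeom.enl ∕ innerN` on `ℤᵈ`): `enl_subset_innerN_enl : X^{∼a} ⊆ (X^{∼(a+b)})^{∼−b}` (cube-index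
  triangle inequality `IdxNear.triangle`);
* §2 (torus side, 11b's `Sect2.enlT ∕ innerT` = `enl ∕ innerN` transported through `B15Eq112TorusCover.cover`): `subset_enlT`, `enlT_mono`,
  `enlT_mono_layers`, `innerT_subset`, `innerT_mono`, and the ladder `enlT_subset_innerT_enlT : Y^{∼a} ⊆ (Y^{∼(a+b)})^{∼−b}` — at
  `a = 3, b = 2`: `□̃³ ⊆ (□̃⁵)^{∼−2}`;
* §3 (regions of site sets, 11b's `Sect2.regionOfSet`, 7a's `plaqInside`): the three index sets are monotone in the site set; the four bonds
  and the two derivative stencils `(x, μ, ν)`, `(x, ν, μ)` of a plaquette `p ⊂ Y` lie in `regionOfSet Y` (`stencil_of_mem_plaqInside`);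
* §4 (11b's frames `Sect2.frameI Rz M j Y`): `X = regionOfSet Y`, `X₂ = regionOfSet (Y^{∼−2})` (`rfl`), hence `X₂ ⊆ X` and monotonicity
  in `Y` on all three index sets.

HONEST FRAMING: lattice bookkeeping (set inclusions on a finite torus); NO estimate; nothing of [Balaban1987RG1] asserted; N09 NOT discharged;
count-neutral; one finite `T⁴` torus at fixed `ε` — NOT continuum ∕ ℝ⁴ ∕ OS ∕ mass gap ∕ Clay.
[Balaban1987RG1] = T. Bałaban, *Renormalization group approach to lattice gauge field theories. I*, Commun. Math. Phys. **109** (1987) 249–301;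
[Balaban1988Convergent] = part [III], Commun. Math. Phys. **119** (1988) 243–285 (the `∼n` ∕ `∼−n` operations (2.1)–(2.3), (2.26)).
-/

open Set

namespace Literature.MathematicalPhysics.QuantumFieldTheory.Balaban1983to89.Node00

open Literature.MathematicalPhysics.QuantumFieldTheory.Balaban1983to89
open Step B14DomainGeom B14.Eq213MaximalDomains B15Eq112TorusCover

namespace Sect2

/-! ## §1  Cover side: the enlargement ladder `X^{∼a} ⊆ (X^{∼(a+b)})^{∼−b}` on `ℤᵈ` -/

section Cover

variable {d : ℕ}

/-- **The enlargement ladder on the cover**: `X^{∼a} ⊆ (X^{∼(a+b)})^{∼−b}` — every side-`s` cube within `b` cubes of a point of `X^{∼a}` is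
within `a + b` cubes of `X` (cube-index triangle inequality).  At `a = 3`, `b = 2`: `□̃³ ⊆ (□̃⁵)^{∼−2}`, the geometry behind «on □̃³» in
(3.37)∕(3.40) for fields given on `□₀ = □̃⁵`. [cite: Balaban1987RG1, p.257 (X̃ⁿ), p.275 («□₀ = □̃⁵»), (3.40) p.278 («on □̃³»)] -/
theorem enl_subset_innerN_enl (s a b : ℕ) (X : Set (Pt d)) : enl s a X ⊆ innerN s b (enl s (a + b) X) := by
  rintro x ⟨z, hz, hxz⟩
  refine ⟨enl_mono_layers s (Nat.le_add_right a b) X ⟨z, hz, hxz⟩, fun y hxy => ⟨z, hz, ?_⟩⟩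
  have h := IdxNear.triangle hxy.symm hxz
  rwa [Nat.add_comm] at h

/-- `X^{∼−b}`'s defining property read as an inclusion: `(X^{∼−b})^{∼b} ⊆ X` for unions of side-`s` cubes is not needed here; what is used
is the pointwise form `x ∈ X^{∼−b}, IdxNear s b x y ⇒ y ∈ X`. [cite: Balaban1988Convergent, (2.26) p.259 (bookkeeping)] -/
theorem mem_of_mem_innerN_of_idxNear {s b : ℕ} {X : Set (Pt d)} {x y : Pt d} (hx : x ∈ innerN s b X) (hxy : IdxNear s b x y) :
    y ∈ X :=
  hx.2 y hxy

end Cover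

/-! ## §2  Torus side: `Sect2.enlT`, `Sect2.innerT` -/

section Torus

variable {P : Params}

/-- Membership in `Y^{∼n}` on the torus: the image of a cover point of `(π⁻¹Y)^{∼n}`. [cite: Balaban1988Convergent, (2.1)–(2.3) pp.254–255 (bookkeeping)] -/
theorem mem_enlT_iff (s n : ℕ) (Y : Set (Site P 0)) (y : Site P 0) :
    y ∈ enlT P s n Y ↔ ∃ x ∈ enl s n (cover P ⁻¹' Y), cover P x = y :=
  Iff.rfl

/-- Membership in `Y^{∼−n}` on the torus: the image of a cover point of `(π⁻¹Y)^{∼−n}`. [cite: Balaban1988Convergent, (2.26) p.259 (bookkeeping)] -/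
theorem mem_innerT_iff (s n : ℕ) (Y : Set (Site P 0)) (y : Site P 0) :
    y ∈ innerT P s n Y ↔ ∃ x ∈ innerN s n (cover P ⁻¹' Y), cover P x = y :=
  Iff.rfl

/-- `Y ⊆ Y^{∼n}`. [cite: Balaban1987RG1, p.257 (X ⊂ X̃ⁿ)] -/
theorem subset_enlT (s n : ℕ) (Y : Set (Site P 0)) : Y ⊆ enlT P s n Y := by
  intro y hy
  obtain ⟨x, rfl⟩ := cover_surjective (P := P) y
  exact ⟨x, subset_enl s n _ hy, rfl⟩

/-- `Y^{∼n}` is monotone in `Y`. [cite: Balaban1987RG1, p.257 (bookkeeping)] -/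
theorem enlT_mono (s n : ℕ) {Y Y' : Set (Site P 0)} (h : Y ⊆ Y') : enlT P s n Y ⊆ enlT P s n Y' := by
  rintro _ ⟨x, hx, rfl⟩
  exact ⟨x, enl_mono s n (preimage_mono h) hx, rfl⟩

/-- `Y^{∼n}` is monotone in the number of layers: `Y^{∼n} ⊆ Y^{∼n′}` for `n ≤ n′` (e.g. `□̃² ⊆ □̃³`: the fundamental case `X ⊂ □̃²` puts
`X` inside `Y = □̃³`). [cite: Balaban1987RG1, p.257 (X̃ⁿ), p.275 («X ⊂ □̃²»)] -/
theorem enlT_mono_layers (s : ℕ) {n n' : ℕ} (h : n ≤ n') (Y : Set (Site P 0)) : enlT P s n Y ⊆ enlT P s n' Y := by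
  rintro _ ⟨x, hx, rfl⟩
  exact ⟨x, enl_mono_layers s h _ hx, rfl⟩

/-- `Y^{∼−n} ⊆ Y` (e.g. `X̃⁻² ⊂ X`, the region of condition (iv) (1.16)). [cite: Balaban1987RG1, (1.16) p.262 («on X̃⁻²»)] -/
theorem innerT_subset (s n : ℕ) (Y : Set (Site P 0)) : innerT P s n Y ⊆ Y := by
  rintro _ ⟨x, hx, rfl⟩
  exact hx.1

/-- `Y^{∼−n}` is monotone in `Y`. [cite: Balaban1988Convergent, (2.26) p.259 (bookkeeping)] -/
theorem innerT_mono (s n : ℕ) {Y Y' : Set (Site P 0)} (h : Y ⊆ Y') : innerT P s n Y ⊆ innerT P s n Y' := by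
  rintro _ ⟨x, hx, rfl⟩
  exact ⟨x, innerN_mono s n (preimage_mono h) hx, rfl⟩

/-- **The enlargement ladder on the torus**: `Y^{∼a} ⊆ (Y^{∼(a+b)})^{∼−b}` for every site set `Y` and cube side `s` (no divisibility or
size hypothesis: the cover-side ladder `enl_subset_innerN_enl` pushed forward, using only `A ⊆ π⁻¹(πA)`).  At `a = 3`, `b = 2`:
`□̃³ ⊆ (□̃⁵)^{∼−2}` — `Y = □̃³` lies in the `X̃⁻²`-region of the frame on `□₀ = □̃⁵`. [cite: Balaban1987RG1, p.275 («□₀ = □̃⁵»), (3.40) p.278 («on □̃³»), (1.16) p.262] -/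
theorem enlT_subset_innerT_enlT (s a b : ℕ) (Y : Set (Site P 0)) : enlT P s a Y ⊆ innerT P s b (enlT P s (a + b) Y) := by
  rintro _ ⟨x, hx, rfl⟩
  have h := enl_subset_innerN_enl s a b (cover P ⁻¹' Y) hx
  exact ⟨x, ⟨⟨x, h.1, rfl⟩, fun y hy => ⟨y, h.2 y hy, rfl⟩⟩, rfl⟩

/-- The ladder with the smaller set enlarged first: `Y^{∼a′} ⊆ (Y^{∼(a+b)})^{∼−b}` for `a′ ≤ a` (e.g. `□̃² ⊆ (□̃⁵)^{∼−2}`).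
[cite: Balaban1987RG1, p.275 («X ⊂ □̃²», «□₀ = □̃⁵»)] -/
theorem enlT_subset_innerT_enlT_of_le (s : ℕ) {a' a : ℕ} (ha : a' ≤ a) (b : ℕ) (Y : Set (Site P 0)) :
    enlT P s a' Y ⊆ innerT P s b (enlT P s (a + b) Y) :=
  (enlT_mono_layers s ha Y).trans (enlT_subset_innerT_enlT s a b Y)

end Torus

/-! ## §3  Regions of site sets: `Sect2.regionOfSet`, `plaqInside` -/

section Regions

variable {P : Params}

/-- One lattice step in direction `μ` then `ν` is the same as `ν` then `μ` (the far corner of a plaquette). [folklore] -/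
private theorem shift_shift_comm {j : ℕ} (x : Site P j) (μ ν : Fin P.d) : (x.shift μ).shift ν = (x.shift ν).shift μ := by
  funext κ
  by_cases h1 : κ = ν
  · subst h1
    by_cases h2 : κ = μ
    · subst h2; rfl
    · simp [Site.shift, Function.update_apply, h2]
  · by_cases h2 : κ = μ
    · subst h2; simp [Site.shift, Function.update_apply, h1]
    · simp [Site.shift, Function.update_apply, h1, h2]

/-- The plaquettes inside a site set are monotone in the set. [cite: Balaban1988Convergent, (2.17) p.257 (bookkeeping)] -/
theorem plaqInside_mono {S S' : Set (Site P 0)} (h : S ⊆ S') : plaqInside S ⊆ plaqInside S' :=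
  fun _ hp => ⟨h hp.1, h hp.2.1, h hp.2.2.1, h hp.2.2.2⟩

/-- The plaquettes of `regionOfSet Y` are the plaquettes with all four corners in `Y` (`rfl`). [cite: Balaban1987RG1, (1.11) p.262 («p ⊂ X»)] -/
theorem regionOfSet_plaqs (Y : Set (Site P 0)) : (regionOfSet P Y).plaqs = plaqInside Y := rfl

/-- The bonds of `regionOfSet Y`: both endpoints in `Y`. [cite: Balaban1987RG1, (1.13) p.262 («b ⊂ X»)] -/
theorem mem_regionOfSet_bonds (Y : Set (Site P 0)) (b : PBond P 0) : b ∈ (regionOfSet P Y).bonds ↔ b.src ∈ Y ∧ b.tgt ∈ Y :=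
  Iff.rfl

/-- The derivative stencils of `regionOfSet Y`: the four corners `x, x+e_μ, x+e_ν, x+e_μ+e_ν` in `Y`. [cite: Balaban1987RG1, (1.14) p.262 («on X»)] -/
theorem mem_regionOfSet_dpairs (Y : Set (Site P 0)) (q : Site P 0 × Fin P.d × Fin P.d) :
    q ∈ (regionOfSet P Y).dpairs ↔ q.1 ∈ Y ∧ q.1.shift q.2.1 ∈ Y ∧ q.1.shift q.2.2 ∈ Y ∧ (q.1.shift q.2.1).shift q.2.2 ∈ Y :=
  Iff.rfl

/-- The plaquettes of `regionOfSet` are monotone in the site set. [cite: Balaban1987RG1, (1.11) p.262 (bookkeeping)] -/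
theorem regionOfSet_plaqs_mono {Y Y' : Set (Site P 0)} (h : Y ⊆ Y') : (regionOfSet P Y).plaqs ⊆ (regionOfSet P Y').plaqs :=
  plaqInside_mono h

/-- The bonds of `regionOfSet` are monotone in the site set. [cite: Balaban1987RG1, (1.13) p.262 (bookkeeping)] -/
theorem regionOfSet_bonds_mono {Y Y' : Set (Site P 0)} (h : Y ⊆ Y') : (regionOfSet P Y).bonds ⊆ (regionOfSet P Y').bonds :=
  fun _ hb => ⟨h hb.1, h hb.2⟩

/-- The derivative stencils of `regionOfSet` are monotone in the site set. [cite: Balaban1987RG1, (1.14) p.262 (bookkeeping)] -/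
theorem regionOfSet_dpairs_mono {Y Y' : Set (Site P 0)} (h : Y ⊆ Y') : (regionOfSet P Y).dpairs ⊆ (regionOfSet P Y').dpairs :=
  fun _ hq => ⟨h hq.1, h hq.2.1, h hq.2.2.1, h hq.2.2.2⟩

/-- **The stencil of a plaquette inside `Y`**: for `p = ⟨x, x+e_μ, x+e_μ+e_ν, x+e_ν⟩ ⊂ Y` its four bonds `⟨x, μ⟩, ⟨x+e_μ, ν⟩, ⟨x+e_ν, μ⟩, ⟨x, ν⟩`
are bonds of `regionOfSet Y` and both derivative stencils `(x, μ, ν)`, `(x, ν, μ)` are stencils of `regionOfSet Y` — the shape of the seventh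
region hypothesis of NODE 00's Lemma-4 package (the plaquette variables of `Uᶜ_j(X, ·)` expressed through bond ∕ derivative data «on Y»).
[cite: Balaban1987RG1, (1.11)–(1.14) p.262, (3.37) p.277 («on □̃³»)] -/
theorem stencil_of_mem_plaqInside {Y : Set (Site P 0)} {p : Plaq P 0} (hp : p ∈ plaqInside Y) :
    (⟨p.src, p.μ⟩ : PBond P 0) ∈ (regionOfSet P Y).bonds ∧ (⟨p.src.shift p.μ, p.ν⟩ : PBond P 0) ∈ (regionOfSet P Y).bonds ∧
      (⟨p.src.shift p.ν, p.μ⟩ : PBond P 0) ∈ (regionOfSet P Y).bonds ∧ (⟨p.src, p.ν⟩ : PBond P 0) ∈ (regionOfSet P Y).bonds ∧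
      (p.src, p.μ, p.ν) ∈ (regionOfSet P Y).dpairs ∧ (p.src, p.ν, p.μ) ∈ (regionOfSet P Y).dpairs := by
  obtain ⟨h0, hμ, hν, hμν⟩ := hp
  have hνμ : (p.src.shift p.ν).shift p.μ ∈ Y := by rw [← shift_shift_comm p.src p.μ p.ν]; exact hμν
  exact ⟨⟨h0, hμ⟩, ⟨hμ, hμν⟩, ⟨hν, hνμ⟩, ⟨h0, hν⟩, ⟨h0, hμ, hν, hμν⟩, ⟨h0, hν, hμ, hνμ⟩⟩

/-- The stencil of every plaquette of `regionOfSet Y` inside a larger set `Y′ ⊇ Y` (the form consumed with `Y := X`, `Y′ := □̃³`).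
[cite: Balaban1987RG1, (1.11)–(1.14) p.262, p.275 («X ⊂ □̃²»)] -/
theorem stencil_of_mem_plaqs_of_subset {Y Y' : Set (Site P 0)} (h : Y ⊆ Y') {p : Plaq P 0} (hp : p ∈ (regionOfSet P Y).plaqs) :
    (⟨p.src, p.μ⟩ : PBond P 0) ∈ (regionOfSet P Y').bonds ∧ (⟨p.src.shift p.μ, p.ν⟩ : PBond P 0) ∈ (regionOfSet P Y').bonds ∧
      (⟨p.src.shift p.ν, p.μ⟩ : PBond P 0) ∈ (regionOfSet P Y').bonds ∧ (⟨p.src, p.ν⟩ : PBond P 0) ∈ (regionOfSet P Y').bonds ∧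
      (p.src, p.μ, p.ν) ∈ (regionOfSet P Y').dpairs ∧ (p.src, p.ν, p.μ) ∈ (regionOfSet P Y').dpairs :=
  stencil_of_mem_plaqInside (plaqInside_mono h hp)

end Regions

/-! ## §4  The frames `Sect2.frameI Rz M j Y` of record: `X`, `X₂` faces and monotonicity -/

section Frames

variable {P : Params} {𝔸 : Type*} [NormedRing 𝔸]

/-- The region `X` of the frame of record on `Y` is `regionOfSet Y` (`rfl`). [cite: Balaban1987RG1, (1.11)–(1.14) p.262] -/
theorem frameI_X (Rz : Residual P 𝔸) (M j : ℕ) (Y : Set (Site P 0)) : (frameI Rz M j Y).X = regionOfSet P Y := rfl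

/-- The region `X̃⁻²` of the frame of record on `Y` is `regionOfSet (Y^{∼−2})` for the side-`L^j M` cubes (`rfl`). [cite: Balaban1987RG1, (1.16) p.262 («on X̃⁻²»)] -/
theorem frameI_X₂ (Rz : Residual P 𝔸) (M j : ℕ) (Y : Set (Site P 0)) :
    (frameI Rz M j Y).X₂ = regionOfSet P (innerT P (side P.L M j) 2 Y) := rfl

/-- `X̃⁻² ⊆ X` on plaquettes, for the frame of record. [cite: Balaban1987RG1, (1.16) p.262] -/
theorem frameI_X₂_plaqs_subset (Rz : Residual P 𝔸) (M j : ℕ) (Y : Set (Site P 0)) : (frameI Rz M j Y).X₂.plaqs ⊆ (frameI Rz M j Y).X.plaqs :=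
  regionOfSet_plaqs_mono (innerT_subset _ _ _)

/-- `X̃⁻² ⊆ X` on bonds, for the frame of record. [cite: Balaban1987RG1, (1.16) p.262] -/
theorem frameI_X₂_bonds_subset (Rz : Residual P 𝔸) (M j : ℕ) (Y : Set (Site P 0)) : (frameI Rz M j Y).X₂.bonds ⊆ (frameI Rz M j Y).X.bonds :=
  regionOfSet_bonds_mono (innerT_subset _ _ _)

/-- `X̃⁻² ⊆ X` on derivative stencils, for the frame of record. [cite: Balaban1987RG1, (1.16) p.262] -/
theorem frameI_X₂_dpairs_subset (Rz : Residual P 𝔸) (M j : ℕ) (Y : Set (Site P 0)) :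
    (frameI Rz M j Y).X₂.dpairs ⊆ (frameI Rz M j Y).X.dpairs :=
  regionOfSet_dpairs_mono (innerT_subset _ _ _)

/-- The region `X` of the frame of record is monotone in the site set, on plaquettes (the residual recipes, cube size and level play no
role in `X`). [cite: Balaban1987RG1, (1.11) p.262 (bookkeeping)] -/
theorem frameI_X_plaqs_mono (Rz Rz' : Residual P 𝔸) (M j M' j' : ℕ) {Y Y' : Set (Site P 0)} (h : Y ⊆ Y') :
    (frameI Rz M j Y).X.plaqs ⊆ (frameI Rz' M' j' Y').X.plaqs :=
  regionOfSet_plaqs_mono h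

/-- The region `X` of the frame of record is monotone in the site set, on bonds. [cite: Balaban1987RG1, (1.13) p.262 (bookkeeping)] -/
theorem frameI_X_bonds_mono (Rz Rz' : Residual P 𝔸) (M j M' j' : ℕ) {Y Y' : Set (Site P 0)} (h : Y ⊆ Y') :
    (frameI Rz M j Y).X.bonds ⊆ (frameI Rz' M' j' Y').X.bonds :=
  regionOfSet_bonds_mono h

/-- The region `X` of the frame of record is monotone in the site set, on derivative stencils. [cite: Balaban1987RG1, (1.14) p.262 (bookkeeping)] -/
theorem frameI_X_dpairs_mono (Rz Rz' : Residual P 𝔸) (M j M' j' : ℕ) {Y Y' : Set (Site P 0)} (h : Y ⊆ Y') :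
    (frameI Rz M j Y).X.dpairs ⊆ (frameI Rz' M' j' Y').X.dpairs :=
  regionOfSet_dpairs_mono h

/-- **`Y^{∼a}` inside the `X̃⁻²` of the frame on `Y^{∼(a+2)}` at the same cube scale**, on plaquettes (at `a = 3`: the plaquettes of `□̃³`,
hence of any `X ⊂ □̃³`, are plaquettes of `(□̃⁵)^{∼−2}` — the sixth∕fifth region hypotheses of the Lemma-4 package).
[cite: Balaban1987RG1, p.275 («□₀ = □̃⁵»), (3.40) p.278, (1.16) p.262] -/
theorem regionOfSet_enlT_plaqs_subset_frameI_X₂ (Rz : Residual P 𝔸) (M j a : ℕ) (C : Set (Site P 0)) :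
    (regionOfSet P (enlT P (side P.L M j) a C)).plaqs ⊆ (frameI Rz M j (enlT P (side P.L M j) (a + 2) C)).X₂.plaqs :=
  regionOfSet_plaqs_mono (enlT_subset_innerT_enlT _ a 2 C)

/-- `Y^{∼a}` inside the `X̃⁻²` of the frame on `Y^{∼(a+2)}` at the same cube scale, on bonds (at `a = 3`: the bonds of `Y = □̃³` are bonds of
`(□̃⁵)^{∼−2}`). [cite: Balaban1987RG1, p.275 («□₀ = □̃⁵»), (3.40) p.278, (1.16) p.262] -/
theorem regionOfSet_enlT_bonds_subset_frameI_X₂ (Rz : Residual P 𝔸) (M j a : ℕ) (C : Set (Site P 0)) :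
    (regionOfSet P (enlT P (side P.L M j) a C)).bonds ⊆ (frameI Rz M j (enlT P (side P.L M j) (a + 2) C)).X₂.bonds :=
  regionOfSet_bonds_mono (enlT_subset_innerT_enlT _ a 2 C)

/-- `Y^{∼a}` inside the `X̃⁻²` of the frame on `Y^{∼(a+2)}` at the same cube scale, on derivative stencils.
[cite: Balaban1987RG1, p.275 («□₀ = □̃⁵»), (3.40) p.278, (1.16) p.262] -/
theorem regionOfSet_enlT_dpairs_subset_frameI_X₂ (Rz : Residual P 𝔸) (M j a : ℕ) (C : Set (Site P 0)) :
    (regionOfSet P (enlT P (side P.L M j) a C)).dpairs ⊆ (frameI Rz M j (enlT P (side P.L M j) (a + 2) C)).X₂.dpairs :=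
  regionOfSet_dpairs_mono (enlT_subset_innerT_enlT _ a 2 C)

end Frames

end Sect2

end Literature.MathematicalPhysics.QuantumFieldTheory.Balaban1983to89.Node00
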